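import Literature.Claims.NS.Rhodes2026
import Literature.Analysis.FluidPDE.VorticityCalculus
import Literature.Analysis.FluidPDE.CurlFreeLiouville
import Summits.NavierStokesRegularity.NavierStokesRegularity.Theorems.SoloRefuteRamm2024
import HarnessLib

/-!
# C142 `Rhodes2026` — kernel refutation of the load-bearing Lemma 3.6 (9)

Cell `ns-claims` (D-0090), claim skeleton `Literature/Claims/NS/Rhodes2026.lean` (typist-1 g5, p519133,
sha16 b433826951ab7c54; text of record Zenodo 19560332 «v09d», 21 pp.). Refuter of record: ns-claims-refuter-4 g4.

VERDICT: first failing step = **Lemma 3.6 (9) p.6 l.30–45** (`Literature.Claims.NS.Rhodes2026.Lemma36`, the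
first hypothesis of the typed composition `claim_of_printed_steps`), class = **false lemma (countermodel)**.

THE DEFECT (amplitude homogeneity). (9) reads `M ≤ C₀ E(t₀)² L⁶/ν³` with `M = ‖ω(·,t₀)‖_∞`,
`E = ½‖ω‖²_{L²}` the ENSTROPHY and `L = 1 + ln⁺(e + ‖ω‖_{H³}/√(2E))`, ONE absolute `C₀`, EVERY `t₀` of the
existence interval including `t₀ = 0`. Under `u ↦ c u` at `t₀ = 0` the left side is degree 1 in `c`, the
right side degree 4 (`E ∝ c²`, `L` is amplitude-invariant), so (9) fails for every `C₀` once `c` is small.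

THE KERNEL WITNESS. `U = curl(φ e₃)` (the tree's Ramm test datum `testDatum`: smooth, compactly supported,
divergence free, `≠ 0`), which has a point `x₁` with `curl U x₁ ≠ 0` (a compactly supported field with
`curl = 0`, `div = 0` is constant by the tree's Liouville theorem, hence `0`). For `ν = 1` and `|c| ≤ c₀`
Kato's small-data theorem (tree `exists_clayA_smul`) gives a smooth bounded-energy solution of (1)–(3) on
`ℝ³ × [0,∞)` from `c U`; restricted to `[0,1)` it is a solution of the typed class `IsSol`. Reading (9) at
`t₀ = 0`, `x = x₁`: `c‖curl U x₁‖ ≤ C₀ c⁴ E_U² L_U⁶`, false for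
`c = min(c₀, 1, ‖curl U x₁‖/(2(C₀E_U²L_U⁶ + 1)))`.

CHARITY (REF ns-claims-ref-2 g6, RETYPE v0 f12a9b56dc3ff86c): CHARITY-R2 (Lemma 3.6 only for `t₀` beyond
the backward window `δt = 1/(4C₃ML)`) is NOT reached by this witness (`t₀ = 0`) — recorded as open, not
refuted; it does not restore the printed chain, whose Theorem 4.1 Step 1 (p.13 l.3–10) applies (9) «at any
time». CHARITY-R3 (Theorem 4.1 as an a priori bound) is Clay (A) itself through the tree's BKM door
(`clayA_of_theorem41`).

Headline: `not_Lemma36 : ¬ Literature.Claims.NS.Rhodes2026.Lemma36` (TYPE-EXACT negation of the typed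
decl; standard axioms).

WHAT THIS IS NOT: not a claim about NS regularity or blow-up; not a claim about any author beyond the
typed locator.
-/

noncomputable section

set_option linter.dupNamespace false

open MeasureTheory Set Filter Function Metric
open scoped Topology ENNReal ContDiff

namespace Summit.NavierStokesRegularity.NavierStokesRegularity.Theorems.Rhodes2026

open Literature.Analysis.FluidPDE Literature.Claims.NS.Rhodes2026
open Summit.NavierStokesRegularity.NavierStokesRegularity.Theorems.Ramm2024 (testDatum contDiff_testDatum
  hasCompactSupport_testDatum isDivFree_testDatum testDatum_ne_zero)

/-! ## W(a) — the test datum `U = curl(φ e₃)` has non-zero vorticity somewhere -/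

/-- `curl (c • v) x = c • curl v x` at a point where `v` is differentiable. [folklore] -/
theorem curl_const_smul_pi {v : E3 → E3} {x : E3} (hv : DifferentiableAt ℝ v x) (c : ℝ) :
    curl (c • v) x = c • curl v x := by
  have h : fderiv ℝ (c • v) x = c • fderiv ℝ v x := fderiv_const_smul hv c
  ext i
  fin_cases i <;> simp [curl, h, mul_sub]

/-- `curl (c • v) = c • curl v` for a differentiable field. [folklore] -/
theorem curl_const_smul_eq {v : E3 → E3} (hv : Differentiable ℝ v) (c : ℝ) :
    curl (c • v) = c • curl v :=
  funext fun x => curl_const_smul_pi (hv x) c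

/-- The test datum vanishes at some point (compact support in the non-compact `ℝ³`). [folklore] -/
theorem exists_testDatum_eq_zero : ∃ x : E3, testDatum x = 0 := by
  by_contra h
  push Not at h
  have hsub : (univ : Set E3) ⊆ support testDatum := fun x _ => h x
  have hK : IsCompact (closure (support testDatum)) := hasCompactSupport_testDatum
  have hcl : closure (support testDatum) = univ := eq_univ_of_univ_subset (hsub.trans subset_closure)
  rw [hcl] at hK
  exact noncompact_univ E3 hK

/-- **W(a)** `U = curl(φ e₃)` is not irrotational: a compactly supported `C²` field with `curl = 0` and
`div = 0` is constant (tree Liouville `eq_of_curl_eq_zero_of_isDivFree_of_bounded`), hence `0` — but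
`testDatum ≠ 0`. [folklore] -/
theorem exists_curl_testDatum_ne_zero : ∃ x : E3, curl testDatum x ≠ 0 := by
  by_contra h
  push Not at h
  have h2 : ContDiff ℝ 2 testDatum := contDiff_infty.1 contDiff_testDatum 2
  have hdiv : VectorCalculus.IsDivFree testDatum := isDivFree_testDatum
  have hcont : Continuous fun x => ‖testDatum x‖ := contDiff_testDatum.continuous.norm
  obtain ⟨C, hC⟩ := (hasCompactSupport_testDatum.norm).exists_bound_of_continuous hcont
  have hconst := eq_of_curl_eq_zero_of_isDivFree_of_bounded h2 h hdiv
    (M := C) (fun x => by simpa using hC x)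
  obtain ⟨x₀, hx₀⟩ := exists_testDatum_eq_zero
  exact testDatum_ne_zero (funext fun x => by rw [hconst x x₀, hx₀]; rfl)

/-! ## W(b) — the scaled data `c • U` are Clay data of the typed class, and the amplitude bookkeeping -/

/-- `c • U` is a datum of the class (smooth, divergence free, compactly supported ⇒ Fefferman decay).
[folklore] -/
theorem isDatum_smul (c : ℝ) : IsDatum (c • testDatum) :=
  ⟨contDiff_testDatum.const_smul c,
    VectorCalculus.IsDivFree.const_smul (contDiff_testDatum.differentiable (by simp)) isDivFree_testDatum c,
    HasRapidSpatialDecay.of_hasCompactSupport (contDiff_testDatum.const_smul c)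
      (hasCompactSupport_testDatum.mono (support_const_smul_subset c testDatum))⟩

/-- The enstrophy `E_U = ½∫|curl U|²` of the test datum. [folklore] -/
def EU : ℝ := (1 / 2) * ∫ x, ‖curl testDatum x‖ ^ 2

/-- `‖curl U‖²_{H³}` of the test datum (the typed `h3NormSq`). [folklore] -/
def HU : ℝ := h3NormSq (curl testDatum)

/-- The logarithmic factor `L_U = 1 + ln⁺(e + ‖curl U‖_{H³}/√(2E_U))` of the test datum. [folklore] -/
def LU : ℝ := 1 + max 0 (Real.log (Real.exp 1 + Real.sqrt HU / Real.sqrt (2 * EU)))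

/-- `E_U ≥ 0`. [folklore] -/
theorem EU_nonneg : 0 ≤ EU :=
  mul_nonneg (by norm_num) (integral_nonneg fun _ => by positivity)

/-- The vorticity of a solution launched from `c • U`, at time `0`: `curl (u 0) = c • curl U`. [folklore] -/
theorem curl_zero_eq {u : ℝ → E3 → E3} {c : ℝ} (h0 : u 0 = c • testDatum) :
    curl (u 0) = c • curl testDatum := by
  rw [h0, curl_const_smul_eq (contDiff_testDatum.differentiable (by simp)) c]

/-- **Enstrophy is quadratic in the amplitude**: `E(0) = c² E_U` for a solution with `u(0) = c U`. [folklore] -/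
theorem enstrophy_zero_eq {u : ℝ → E3 → E3} {c : ℝ} (h0 : u 0 = c • testDatum) :
    enstrophy u 0 = c ^ 2 * EU := by
  have hpt : (fun x => ‖(c • curl testDatum) x‖ ^ 2) = fun x => c ^ 2 * ‖curl testDatum x‖ ^ 2 := by
    funext x
    simp only [Pi.smul_apply, norm_smul, Real.norm_eq_abs, mul_pow, sq_abs]
  unfold Literature.Claims.NS.Rhodes2026.enstrophy EU
  rw [curl_zero_eq h0, hpt, integral_const_mul]
  ring

/-- **The `H³` quantity is quadratic in the amplitude**: `‖c w‖²_{H³} = c²‖w‖²_{H³}` for smooth `w`. [folklore] -/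
theorem h3NormSq_smul {w : E3 → E3} (hw : ContDiff ℝ ∞ w) (c : ℝ) :
    h3NormSq (c • w) = c ^ 2 * h3NormSq w := by
  unfold h3NormSq
  rw [Finset.mul_sum]
  refine Finset.sum_congr rfl fun n _ => ?_
  have hpt : (fun x => ‖iteratedFDeriv ℝ n (c • w) x‖ ^ 2) =
      fun x => c ^ 2 * ‖iteratedFDeriv ℝ n w x‖ ^ 2 := by
    funext x
    have hn : ContDiffAt ℝ n w x := (hw.of_le (by exact_mod_cast le_top)).contDiffAt
    rw [iteratedFDeriv_const_smul_apply hn, norm_smul, Real.norm_eq_abs, mul_pow, sq_abs]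
  rw [hpt, integral_const_mul]

/-- `curl U` is smooth. [folklore] -/
theorem contDiff_curl_testDatum : ContDiff ℝ ∞ (curl testDatum) :=
  contDiff_curl (n := (⊤ : ℕ∞)) (by exact_mod_cast contDiff_testDatum)

/-- **The logarithmic factor is amplitude-invariant**: `L(0) = L_U` for a solution with `u(0) = c U`,
`c ≠ 0` (numerator and denominator of the ratio inside `ln⁺` both scale by `|c|`). [folklore] -/
theorem logFactor_zero_eq {u : ℝ → E3 → E3} {c : ℝ} (hc : c ≠ 0) (h0 : u 0 = c • testDatum) :
    logFactor u 0 = LU := by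
  unfold logFactor LU HU
  rw [enstrophy_zero_eq h0, curl_zero_eq h0, h3NormSq_smul contDiff_curl_testDatum c,
    show (2 : ℝ) * (c ^ 2 * EU) = c ^ 2 * (2 * EU) by ring,
    Real.sqrt_mul (sq_nonneg c), Real.sqrt_mul (sq_nonneg c), Real.sqrt_sq_eq_abs,
    mul_div_mul_left _ _ (abs_pos.2 hc).ne']

/-- **W(c)** Kato: for `ν > 0` the small multiples `c • U`, `|c| ≤ c₀`, launch smooth bounded-energy
solutions of the unforced system on `ℝ³ × [0,∞)` (tree `exists_clayA_smul`). [cite: Kato1984MathZ, Thm. 2 (p. 472)] -/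
theorem exists_small_solutions {ν : ℝ} (hν : 0 < ν) :
    ∃ c₀ : ℝ, 0 < c₀ ∧ ∀ c : ℝ, |c| ≤ c₀ →
      ∃ (u : ℝ → E3 → E3) (p : ℝ → E3 → ℝ),
        IsSmoothOnHalfSpace u ∧ IsSmoothOnHalfSpace p ∧
          IsNavierStokesSolution ν 0 (c • testDatum) u p ∧ HasBoundedEnergy u :=
  Literature.Barriers.NavierStokesRegularity.exists_clayA_smul hν contDiff_testDatum isDivFree_testDatum
    (HasRapidSpatialDecay.of_hasCompactSupport contDiff_testDatum hasCompactSupport_testDatum)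

/-- A Clay-class global solution from `c • U` is a solution of the typed class on `[0,1)`. [folklore] -/
theorem isSol_of_clay {ν c : ℝ} {u : ℝ → E3 → E3} {p : ℝ → E3 → ℝ} (hu : IsSmoothOnHalfSpace u)
    (hp : IsSmoothOnHalfSpace p) (hns : IsNavierStokesSolution ν 0 (c • testDatum) u p)
    (hE : HasBoundedEnergy u) : IsSol ν (c • testDatum) 1 u p where
  datum := isDatum_smul c
  classical :=
    (hns.isClassicalNSSolutionOn_Icc hu hp one_pos).mono Ico_subset_Icc_self (uniqueDiffOn_Ico 0 1)
  initial := hns.initial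
  energy := by
    obtain ⟨C, hC, hb⟩ := hE
    exact ⟨C, hC, fun t ht => hb t ht.1⟩

/-! ## The refutation -/

/-- **C142 KILL — Lemma 3.6 (9) p.6 l.30–45 is false as typed** (`¬ Lemma36`, TYPE-EXACT): for any
proposed absolute `C₀`, the Kato solution from `c • U` (`ν = 1`) violates
`|ω(x₁,0)| ≤ C₀ E(0)² L(0)⁶/ν³` at the point `x₁` of non-zero vorticity once
`0 < c ≤ min(c₀, 1, |curl U(x₁)|/(2(C₀E_U²L_U⁶+1)))`: the left side is `c|curl U(x₁)|`, the right side
`C₀c⁴E_U²L_U⁶`. Class: false lemma (countermodel) — amplitude homogeneity, degree 1 versus degree 4.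
[cite: Rhodes2026, Lemma 3.6 (9) p.6 l.30–45] [cite: Kato1984MathZ, Thm. 2 (p. 472)] -/
theorem not_Lemma36 : ¬ Lemma36 := by
  rintro ⟨C₀, hC₀, h⟩
  obtain ⟨x₁, hx₁⟩ := exists_curl_testDatum_ne_zero
  have hm0 : 0 < ‖curl testDatum x₁‖ := norm_pos_iff.2 hx₁
  set m : ℝ := ‖curl testDatum x₁‖ with hm
  obtain ⟨c₀, hc₀, hsol⟩ := exists_small_solutions one_pos
  set Q : ℝ := C₀ * EU ^ 2 * LU ^ 6 with hQ
  have hQ0 : 0 ≤ Q := by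
    have := EU_nonneg
    positivity
  set c : ℝ := min c₀ (min 1 (m / (2 * (Q + 1)))) with hc
  have hc0 : 0 < c := lt_min hc₀ (lt_min one_pos (div_pos hm0 (by positivity)))
  have hcc₀ : c ≤ c₀ := min_le_left _ _
  have hc1 : c ≤ 1 := (min_le_right _ _).trans (min_le_left _ _)
  have hcm : c ≤ m / (2 * (Q + 1)) := (min_le_right _ _).trans (min_le_right _ _)
  obtain ⟨u, p, hu, hp, hns, hE⟩ := hsol c (by rw [abs_of_pos hc0]; exact hcc₀)
  have hS : IsSol 1 (c • testDatum) 1 u p := isSol_of_clay hu hp hns hE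
  have h0 : (0 : ℝ) ∈ Ico (0 : ℝ) 1 := ⟨le_rfl, one_pos⟩
  have key := h 1 (c • testDatum) 1 u p one_pos hS 0 h0 x₁
  rw [curl_zero_eq hns.initial, Pi.smul_apply, norm_smul, Real.norm_eq_abs, abs_of_pos hc0,
    enstrophy_zero_eq hns.initial, logFactor_zero_eq hc0.ne' hns.initial] at key
  -- key : c * m ≤ C₀ * (c ^ 2 * EU) ^ 2 * LU ^ 6 / 1 ^ 3
  have key' : c * m ≤ c * (c ^ 3 * Q) := by
    rw [hQ]
    convert key using 1
    ring
  have h1 : m ≤ c ^ 3 * Q := le_of_mul_le_mul_left key' hc0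
  have h2 : c ^ 3 * Q ≤ c * Q :=
    mul_le_mul_of_nonneg_right (pow_le_of_le_one hc0.le hc1 three_ne_zero) hQ0
  have h3 : c * Q ≤ m / (2 * (Q + 1)) * Q := mul_le_mul_of_nonneg_right hcm hQ0
  have h4 : m / (2 * (Q + 1)) * Q < m := by
    rw [div_mul_eq_mul_div, div_lt_iff₀ (by positivity)]
    nlinarith
  linarith

/-- The typed composition `claim_of_printed_steps` consumes `Lemma36` as its FIRST hypothesis; recorded:
with the other four printed steps granted, the printed chain to Thm 1.1 has a false first premise (this is
a statement about the typed chain, not about `ClaimedTheorem`). [cite: Rhodes2026, p.3 l.55–60; Remark 4.3 p.14–15] -/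
theorem printed_chain_first_premise_false :
    ¬ (Lemma36 ∧ Prop42 ∧ Step3_Closure ∧ Step_Gronwall41 ∧ Step4_Bootstrap) :=
  fun h => not_Lemma36 h.1

/-- info: 'Summit.NavierStokesRegularity.NavierStokesRegularity.Theorems.Rhodes2026.not_Lemma36' depends on axioms: [propext, Classical.choice, Quot.sound] -/
#guard_msgs (whitespace := lax) in
#print axioms not_Lemma36

end Summit.NavierStokesRegularity.NavierStokesRegularity.Theorems.Rhodes2026

end

-- WHAT THIS IS NOT: not a claim about NS regularity or blow-up; not a claim about any author beyond the
-- typed locator.
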